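import Literature.MathematicalPhysics.QuantumFieldTheory.Balaban1983to89.B1Ineq225DerivDecayBackgroundTorus
import Literature.MathematicalPhysics.QuantumFieldTheory.Balaban1983to89.B1TorusCubeHolderProbe
import Literature.MathematicalPhysics.QuantumFieldTheory.Balaban1983to89.B1TorusCubeHolderInput

/-!
# `Balaban1983to89.B1Ineq224BackgroundTorusWalk` — [Balaban1983RegularityDecay] THEOREM (1.9), THE HÖLDER MEMBER WITH ITS DECAY FACTOR, ON
# THE TORUS `Ω = T_ε` MODULO THE PER-CUBE INPUTS, for the (Higgs)₂,₃ covariance operator of [Balaban1982Higgs1] (2.20): the walk (2.13)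
# summed in the weighted sup norm for the HÖLDER PROBE `F ↦ U(A(Γ_{x,x′}))(D^ε_AF)(⟨x′,μ⟩) − (D^ε_AF)(⟨x,μ⟩)` («|x′ − x| ≤ 1», p. 578) —
# this seat's abstract `B4Eq222SupDecayObs` with the one-letter estimate `B1TorusCubeHolderProbe.norm_probe_hsmul_le` — AND THE FOUR PER-CUBE
# INPUTS OF LEMMA 2.2 AT `Ã_j` FOR THE REGULAR BACKGROUND `A^{(K),ε}` OF [Balaban1982Higgs1] (3.29) (value, derivative, Hölder, (2.20) factor)

statement-level skeleton of published theorems with citation tags; proofs where landed; nothing here is a claim about the Yang–Mills mass gap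

CITATION HEADER (lean-in-tree rule).  T. Bałaban, *Regularity and decay of lattice Green's functions*, Commun. Math. Phys. **89** (1983)
571–597 [Balaban1983RegularityDecay] (pp. 573 (1.9), 577–579 (2.12)–(2.13), (2.18)–(2.22)) and T. Bałaban, *(Higgs)₂,₃ quantum fields in a
finite volume. I*, Commun. Math. Phys. **85** (1982) 603–626 [Balaban1982Higgs1] (Prop. 2.1 (2.23)–(2.24) p. 610, (3.29) p. 617).  Cell `lit-balaban` (HOME
`run/shared/lean/pub/lit-balaban/`), Phase-2 proof seat **p35** gen 10 (unit `lit-balaban-p35`); SKELETON rows **B4.Thm@573** ((1.9) Hölder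
member with `exp(−δ₀dist)` on the torus, modulo Lemma 2.2), **B4.Eq2.18**/(2.20)/(2.22), **B4.Lem2.2** (inputs at `Ã_j` for `A^{(K),ε}`),
**B1.Prop2.1** ((2.24) at `A ≠ 0`, `Ω = T_ε`).
USED BY NAME, never restated: gen 9's `B4Eq222SupDecayObs.norm_obs_inverse_apply_le_of_dist`, `B1Ineq225DerivDecayBackgroundTorus.covDeriv_hsmul_eq_zero_off`,
`B1Ineq225DecayBackgroundTorus.tdist_le_of_near`; gen 8's `B1TorusCubeCover`/`B1TorusCubeLocality26` (`hTor`, `sum_hTor_sq`, `card_filter_near_le`,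
`covOpK_hTor_agree`, `commutator_row_zero`, `rS`, `cubeVec`); the typer's `HiggsCovariance.{covOpK, propagatorK}`, `HiggsCovariancePos.{isUnit_covOpK,
covOpK_mul_propagatorK}`; r14/r15's `tdist_triangle_real`/`tdist_self`; this seat's `B1TorusChainTransport.{hol, IsTChain, near_chain_bwd}`,
`B1TorusCubeHolderProbe.norm_probe_hsmul_le`; for §2: gen 8's `B1TorusCubeBoxOp.cube_inputs`, gen 9's `B1TorusCubeDerivInput.cube_input_deriv`,
this seat's `B1TorusCubeHolderInput.cube_input_holder`, gen 8's `B1Ineq225BackgroundTorus.{norm_sderiv_bgVec_le, apply_shift_sub_eq}` ((2.23) of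
the background), r15's `B1Ineq225DerivZeroFieldTorus.covDeriv_propagatorK_sup_bound`.

WHAT IS PRINTED.  p. 573: *«(1/|x − x′|^α)|U(A(Γ_{x,x′}))(D^η_{A,μ}G_k(Ω,A)f)(x′) − (D^η_{A,μ}G_k(Ω,A)f)(x)| ≤ c₀exp(−δ₀dist({x,x′}, supp f))‖f‖_∞
(1.9)»*; p. 578: *«hence we can assume |x′ − x| ≤ 1 … We restrict the summation in (2.13) to paths starting in the corresponding j's and we will
prove the inequality (1.9) using the representation (2.13): (the left hand side of (1.9)) ≤ Σ′_ω ‖h_{ω₀}G_k(□_{ω₀},A_{ω₀})h_{ω₀}K_{ω₁}G_k ⋯ h_{ω_n}f‖_{1,α}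
(2.18) … Σ′ ‖h_{ω₀}G_k(□_{ω₀},A_{ω₀})h_{ω₀}‖_{(1,α),∞} Π_i ‖K_{ω_i}G_k(□_{ω_i},A_{ω_i})h_{ω_i}‖_{∞,∞}‖f‖_∞ (2.20)»*; p. 579 (2.22) and *«Finally
let us notice that if Ω is a rectangular parallelepiped, then all □_j in the representation (2.13) are cubes and we can apply Lemma 2.2 to all
operators in it, so the restriction dist({x,x′},Ω^c) ≥ R₀ is unnecessary»* (on the torus every cube is interior).

WHAT THIS FILE PROVES (kernel-checked, zero `sorry`, theorems only; axioms standard).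
* `probe_hsmul_eq_zero_off` — LOCALITY OF THE HÖLDER PROBE: if `x` is farther than `rS + d·L^K + 2` from `Mj` then
  `U(A(Γ))D^ε_A(h_jF)(⟨x′,μ⟩) − D^ε_A(h_jF)(⟨x,μ⟩) = 0` (both derivatives vanish; `|Γ| ≤ d·L^K`).
* **`norm_holder_propagatorK_univ_le`** — THEOREM (1.9) ON `T_ε` IN THE REGIME `|x − x′| ≤ L^K`, MODULO THE CUBE INPUTS: for ANY `A`, `m² > 0`,
  `a_K ≥ 0`, ROOM `4(rS + d·L^K + 2) ≤ 3M`, per-cube inputs at `Ã_j` (`‖G_j(h_jψ)‖_∞ ≤ γ₀‖ψ‖`, `‖D^ε_{Ã_j}G_j(h_jψ)‖ ≤ γ_D‖ψ‖` on the bonds of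
  `□_j`, the Hölder input `γ_H‖ψ‖` for the given contour, `‖K_jG_j(h_jψ)‖ ≤ β‖ψ‖`) and `δ ≥ 0` with `2^dβe^{2δ(rS + dL^K + 2)} ≤ ½`:
  `‖U(A(Γ))(D^ε_AG^ε_K(T_ε,A)φ)(⟨x′,μ⟩) − (D^ε_AG^ε_K(T_ε,A)φ)(⟨x,μ⟩)‖ ≤ 2·2^d·γ_Te^{2δ(rS+dL^K+2)}·e^{−δD}·M` for `‖φ‖ ≤ M` vanishing within
  (1.3)-distance `D` of `x`, where `γ_T = γ_H + δ₁(2|Γ|+2)n⁻¹γ_D + δ₂d|Γ|(n²ε)⁻¹γ₀` is the one-letter constant of `norm_probe_hsmul_le`.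
* §2 `cube_inputs_holder_bgVec` — THE FOUR PER-CUBE INPUTS AT `Ã_j` FOR THE BACKGROUND `A^{(K),ε}`: constants `C_γ, C_δ, C_H, C_β > 0` and
  thresholds `c_A(K₀) > 0` with, for `K₀ ≥ 8`, `K₀ ∣ M`, `1 ≤ K ≤ K_P`, `3L^KK₀ ≤ |T_ε|_μ`, `L^Kε ≤ ε₀`, `r·L^Kε ≤ c_A(K₀)`, `|A| ≤ r`:
  `‖G_j(h_jψ)‖_∞ ≤ C_γ(L^Kε)²‖ψ‖`, `‖D^ε_{Ã_j}G_j(h_jψ)‖ ≤ C_δ(L^Kε)‖ψ‖` on the bonds of `□_j`, the Hölder member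
  `‖U(Ã_j(Γ))D^ε_{Ã_j}G_j(h_jψ)(⟨x′,μ⟩) − D^ε_{Ã_j}G_j(h_jψ)(⟨x,μ⟩)‖ ≤ C_H(|x − x′|/L^K)^α(L^Kε)‖ψ‖` (`Γ ⊂ □_j`, `|Γ| ≤ d|x − x′|`), and
  `‖K_jG_j(h_jψ)‖ ≤ (C_β/K₀)‖ψ‖` — at the common charge `e_c = min(e₁, e₂, e₃)` of the three Lemma-2.2 thresholds (pattern of gen 9's
  `cube_inputs_deriv_bgVec`).
HONEST SCOPE: §1 is the near regime of (1.9) only and modulo the inputs, for any `A`; §2 supplies the inputs at `A^{(K),ε}`; the two regimes are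
assembled in the companion `B1Ineq224BackgroundTorus`; the walk is summed in the exponentially weighted sup norm (declared deviation of
`B4Eq222SupDecay`); `Ω = T_ε`; `0 ≤ α < 1`.  Unit `lit-balaban-p35` gen 10 (literature-prover-lit-balaban-p35-g10-0).
-/

open scoped BigOperators

noncomputable section

namespace Literature.MathematicalPhysics.QuantumFieldTheory.Balaban1983to89.B1Ineq224BackgroundTorusWalk

open Literature.MathematicalPhysics.QuantumFieldTheory.Balaban1983to89.HiggsLattice (ChargeData sderiv covDeriv)
open Literature.MathematicalPhysics.QuantumFieldTheory.Balaban1983to89.HiggsCovariance (propagatorK covOpK)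
open Literature.MathematicalPhysics.QuantumFieldTheory.Balaban1983to89.HiggsCovariancePos (isUnit_covOpK covOpK_mul_propagatorK)
open Literature.MathematicalPhysics.QuantumFieldTheory.Balaban1983to89.B1TorusCubeCover (half Lab Near cube hTor card_filter_near_le sum_hTor_sq
  abs_hTor_le_one near_mono)
open Literature.MathematicalPhysics.QuantumFieldTheory.Balaban1983to89.B1TorusCubeLocality26 (rS cubeVec covOpK_hTor_agree commutator_row_zero
  near_rS_of_hTor_ne_zero near_rS_of_hTor_shift_ne_zero rS_succ_lt_half)
open Literature.MathematicalPhysics.QuantumFieldTheory.Balaban1983to89.B3MultiscaleFields (toSite zeroCharge)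
open Literature.MathematicalPhysics.QuantumFieldTheory.Balaban1983to89.B1Eq31Concrete (bgVec)
open Literature.MathematicalPhysics.QuantumFieldTheory.Balaban1983to89.B1Eq211ZeroFieldTorus (Shape)
open Literature.MathematicalPhysics.QuantumFieldTheory.Balaban1983to89.B1Ineq225DerivZeroFieldTorus (covDeriv_propagatorK_sup_bound)
open Literature.MathematicalPhysics.QuantumFieldTheory.Balaban1983to89.B1TorusCubeChart (dd dd_succ castD toT toT_add_e1)
open Literature.MathematicalPhysics.QuantumFieldTheory.Balaban1983to89.B1TorusCubeBoxOp (acT cube_inputs)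
open Literature.MathematicalPhysics.QuantumFieldTheory.Balaban1983to89.B1TorusCubeDerivInput (cube_input_deriv)
open Literature.MathematicalPhysics.QuantumFieldTheory.Balaban1983to89.B4Lemma22ReduceZero (Box)
open Literature.MathematicalPhysics.QuantumFieldTheory.Balaban1983to89.B4Lower18Regular (e1)
open Literature.MathematicalPhysics.QuantumFieldTheory.Balaban1983to89.B1Ineq225BackgroundTorus (apply_shift_sub_eq norm_sderiv_bgVec_le)
open Literature.MathematicalPhysics.QuantumFieldTheory.Balaban1983to89.B1TorusCubeHolderInput (cube_input_holder)
open Literature.MathematicalPhysics.QuantumFieldTheory.Balaban1983to89.B4GaugeCovariance (pathEnd)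
open Literature.MathematicalPhysics.QuantumFieldTheory.Balaban1983to89.B4PartitionUnity22 (hprof D1 D2 D1_nonneg D2_nonneg contDiff_hprof
  hasCompactSupport_hprof)
open Literature.MathematicalPhysics.QuantumFieldTheory.Balaban1983to89.B1Ineq225DecayBackgroundTorus (tdist_le_of_near)
open Literature.MathematicalPhysics.QuantumFieldTheory.Balaban1983to89.B1Ineq225DerivDecayBackgroundTorus (covDeriv_hsmul_eq_zero_off)
open Literature.MathematicalPhysics.QuantumFieldTheory.Balaban1983to89.B4Eq222SupDecayObs (norm_obs_inverse_apply_le_of_dist)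
open Literature.MathematicalPhysics.QuantumFieldTheory.Balaban1983to89.B1Ineq234LevelZero (tdist_triangle_real)
open Literature.MathematicalPhysics.QuantumFieldTheory.Balaban1983to89.B1Ineq234Concrete (tdist_self)
open Literature.MathematicalPhysics.QuantumFieldTheory.Balaban1983to89.B1TorusChainTransport
open Literature.MathematicalPhysics.QuantumFieldTheory.Balaban1983to89.B1TorusCubeHolderProbe (norm_probe_hsmul_le)

variable {P : HiggsLattice.Params} {N : ℕ}

/-! ## §1 The walk for the Hölder probe on `T_ε`, modulo the cube inputs -/

section Torus

variable {K K₀ : ℕ}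

/-- **LOCALITY OF THE HÖLDER PROBE**: if `x` is farther than `rS + d·L^K + 2` from `Mj` and the contour has `|Γ| ≤ d·L^K`, then both
`D^ε_A(h_jF)(⟨x,μ⟩)` and `D^ε_A(h_jF)(⟨x′,μ⟩)` vanish, so the probe of `h_jF` is zero («If any of the points x, x′ belongs to supp h_j, then both
belong to □_j», p. 578). [cite: Balaban1983RegularityDecay, (2.18) p.578; (2.7) p.576] -/
theorem probe_hsmul_eq_zero_off (C : ChargeData N) (hK : K ≤ P.K) (hK₀ : K₀ ∣ P.M) (hK₀8 : 8 ≤ K₀) (j : Lab P K K₀)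
    (A : HiggsLattice.VecField P 0) (F : HiggsLattice.ScalarField P 0 N) {μ : Fin P.d} {x x' : HiggsLattice.Site P 0}
    {l : List (HiggsLattice.Site P 0)} (hch : IsTChain x l) (hend : pathEnd x l = x') (hlenN : l.length ≤ P.d * P.L ^ K)
    (hx : ¬ Near K K₀ (rS P K K₀ + P.d * P.L ^ K + 2) j x) :
    hol C A x l (covDeriv C A (hTor K K₀ j • F) ⟨x', μ⟩) - covDeriv C A (hTor K K₀ j • F) ⟨x, μ⟩ = 0 := by
  have h1 : ¬ Near K K₀ (rS P K K₀) j x := fun h => hx (near_mono (by omega) h)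
  have h2 : ¬ Near K K₀ (rS P K K₀) j x' := by
    intro h
    rw [← hend] at h
    have h' := near_chain_bwd hch h x (by simp)
    exact hx (near_mono (by omega) h')
  rw [covDeriv_hsmul_eq_zero_off C hK hK₀ hK₀8 j A F (b := ⟨x', μ⟩) h2,
    covDeriv_hsmul_eq_zero_off C hK hK₀ hK₀8 j A F (b := ⟨x, μ⟩) h1, map_zero, sub_zero]

set_option maxHeartbeats 800000 in
/-- **THEOREM (1.9), HÖLDER MEMBER WITH ITS DECAY FACTOR, ON THE TORUS `Ω = T_ε`, REGIME `|x − x′| ≤ L^K` — modulo the cube inputs.**  `m² > 0`,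
`a_K ≥ 0`, `K ≤ K_P`, `K₀ ∣ M_P`, `K₀ ≥ 8`, `3M ≤ |T_ε|_μ`, room `4(rS + dL^K + 2) ≤ 3M`, ANY `A`; sites `x, x′` at (1.3)-distance `≤ L^K` joined by
a nearest-neighbour chain `Γ` with `|Γ| ≤ d|x − x′|`; per-cube inputs at `Ã_j` for `u_j = G_j(h_jψ)`: `‖u_j‖_∞ ≤ γ₀‖ψ‖`, `‖D^ε_{Ã_j}u_j(b)‖ ≤ γ_D‖ψ‖`
on the bonds of `□_j`, the Hölder input `‖U(Ã_j(Γ))D^ε_{Ã_j}u_j(⟨x′,μ⟩) − D^ε_{Ã_j}u_j(⟨x,μ⟩)‖ ≤ γ_H‖ψ‖` (when `x, x+εe_μ, x′, x′+εe_μ, Γ ⊂ □_j`),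
`‖(H_jh_j − h_jH_j)u_j‖ ≤ β‖ψ‖`, and `δ ≥ 0` with `2^d·β·e^{2δ(rS + dL^K + 2)} ≤ ½`.  Then for `‖φ‖ ≤ M` vanishing within (1.3)-distance `D` of `x`:
`‖U(A(Γ))(D^ε_AG^ε_K(T_ε,A)φ)(⟨x′,μ⟩) − (D^ε_AG^ε_K(T_ε,A)φ)(⟨x,μ⟩)‖ ≤ 2·2^d·γ_T·e^{2δ(rS+dL^K+2)}·e^{−δD}·M`,
`γ_T = γ_H + δ₁(2|Γ| + 2)n⁻¹γ_D + δ₂d|Γ|(n²ε)⁻¹γ₀` (`δ₁ = d(D₁+D₂)/K₀`, `δ₂ = (D₁²+D₂)/K₀²`, `n = L^K`).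
[cite: Balaban1983RegularityDecay, Theorem (1.9) p.573; (2.12)–(2.13) p.577; (2.18)–(2.20) p.578; (2.22) p.579]
[cite: Balaban1982Higgs1, Prop. 2.1 (2.24) p.610] -/
theorem norm_holder_propagatorK_univ_le (C : ChargeData N) (hK : K ≤ P.K) (hK₀ : K₀ ∣ P.M) (hK₀8 : 8 ≤ K₀)
    (hN3 : ∀ μ, 3 * half P K K₀ ≤ P.sitesPerDir 0 μ) (hroom : 4 * (rS P K K₀ + P.d * P.L ^ K + 2) ≤ 3 * half P K K₀)
    {msq : ℝ} (hmsq : 0 < msq) (a : ℝ) (hak : 0 ≤ B1.aSeq a P.L K) (A : HiggsLattice.VecField P 0)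
    {γ0 γD γH β : ℝ} (hγ0 : 0 ≤ γ0) (hγD : 0 ≤ γD) (hγH : 0 ≤ γH) (hβ : 0 ≤ β)
    {μ : Fin P.d} {x x' : HiggsLattice.Site P 0} {l : List (HiggsLattice.Site P 0)} (hch : IsTChain x l) (hend : pathEnd x l = x')
    (hlen : (l.length : ℝ) ≤ (P.d : ℝ) * HiggsLattice.Site.tdist x x') (hnear : HiggsLattice.Site.tdist x x' ≤ P.L ^ K)
    (hGj : ∀ (j : Lab P K K₀) (ψ : HiggsLattice.ScalarField P 0 N),
      ‖propagatorK C (cube K K₀ j) (cubeVec K K₀ j A) msq a K (hTor K K₀ j • ψ)‖ ≤ γ0 * ‖ψ‖)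
    (hDj : ∀ (j : Lab P K K₀) (ψ : HiggsLattice.ScalarField P 0 N) (y : HiggsLattice.Site P 0) (ν : Fin P.d),
      y ∈ cube K K₀ j → y.shift ν ∈ cube K K₀ j →
      ‖covDeriv C (cubeVec K K₀ j A) (propagatorK C (cube K K₀ j) (cubeVec K K₀ j A) msq a K (hTor K K₀ j • ψ)) ⟨y, ν⟩‖ ≤ γD * ‖ψ‖)
    (hHj : ∀ (j : Lab P K K₀) (ψ : HiggsLattice.ScalarField P 0 N), x ∈ cube K K₀ j → x.shift μ ∈ cube K K₀ j → x' ∈ cube K K₀ j →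
      x'.shift μ ∈ cube K K₀ j → (∀ y ∈ l, y ∈ cube K K₀ j) →
      ‖hol C (cubeVec K K₀ j A) x l
            (covDeriv C (cubeVec K K₀ j A) (propagatorK C (cube K K₀ j) (cubeVec K K₀ j A) msq a K (hTor K K₀ j • ψ)) ⟨x', μ⟩)
          - covDeriv C (cubeVec K K₀ j A) (propagatorK C (cube K K₀ j) (cubeVec K K₀ j A) msq a K (hTor K K₀ j • ψ)) ⟨x, μ⟩‖
        ≤ γH * ‖ψ‖)
    (hKj : ∀ (j : Lab P K K₀) (ψ : HiggsLattice.ScalarField P 0 N),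
      ‖covOpK C (cube K K₀ j) (cubeVec K K₀ j A) msq a K
          (hTor K K₀ j • propagatorK C (cube K K₀ j) (cubeVec K K₀ j A) msq a K (hTor K K₀ j • ψ))
        - hTor K K₀ j • covOpK C (cube K K₀ j) (cubeVec K K₀ j A) msq a K
          (propagatorK C (cube K K₀ j) (cubeVec K K₀ j A) msq a K (hTor K K₀ j • ψ))‖ ≤ β * ‖ψ‖)
    {δ : ℝ} (hδ : 0 ≤ δ) (hsmall : (2 : ℝ) ^ P.d * β * Real.exp (δ * (2 * (rS P K K₀ + P.d * P.L ^ K + 2 : ℕ))) ≤ 1 / 2)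
    (φ : HiggsLattice.ScalarField P 0 N) {M : ℝ} (hφ : ∀ y, ‖φ y‖ ≤ M) {D : ℝ} (hD0 : 0 ≤ D)
    (hD : ∀ y, φ y ≠ 0 → D ≤ (HiggsLattice.Site.tdist x y : ℝ)) :
    ‖hol C A x l (covDeriv C A (propagatorK C Finset.univ A msq a K φ) ⟨x', μ⟩) - covDeriv C A (propagatorK C Finset.univ A msq a K φ) ⟨x, μ⟩‖
      ≤ 2 * 2 ^ P.d * ((γH + ((dd P : ℝ) + 1) * (D1 hprof + D2 hprof) / K₀ * ((2 * l.length + 2) / (((P.L - 1 + 1) ^ K : ℕ) : ℝ)) * γD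
              + (D1 hprof ^ 2 + D2 hprof) / (K₀ : ℝ) ^ 2 * ((P.d : ℝ) * l.length / ((((P.L - 1 + 1) ^ K : ℕ) : ℝ) ^ 2 * P.mesh 0)) * γ0)
            * Real.exp (δ * (2 * (rS P K K₀ + P.d * P.L ^ K + 2 : ℕ)))) * Real.exp (-(δ * D)) * M := by
  classical
  have hK₀' : 1 ≤ K₀ := le_trans (by norm_num) hK₀8
  have hD1 := D1_nonneg contDiff_hprof hasCompactSupport_hprof
  have hD2 := D2_nonneg contDiff_hprof hasCompactSupport_hprof
  have hε : 0 < P.mesh 0 := P.mesh_pos 0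
  have hK₀r : (0 : ℝ) < K₀ := by exact_mod_cast hK₀'
  set rH : ℕ := rS P K K₀ + P.d * P.L ^ K + 2 with hrH
  have hrH_lt : rH < half P K K₀ := by omega
  have hlenN : l.length ≤ P.d * P.L ^ K := by
    have h1 : (l.length : ℝ) ≤ (P.d : ℝ) * (P.L ^ K : ℕ) := hlen.trans (mul_le_mul_of_nonneg_left (by exact_mod_cast hnear) (Nat.cast_nonneg _))
    exact_mod_cast h1
  -- the one-letter constant
  set γT : ℝ := γH + ((dd P : ℝ) + 1) * (D1 hprof + D2 hprof) / K₀ * ((2 * l.length + 2) / (((P.L - 1 + 1) ^ K : ℕ) : ℝ)) * γD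
      + (D1 hprof ^ 2 + D2 hprof) / (K₀ : ℝ) ^ 2 * ((P.d : ℝ) * l.length / ((((P.L - 1 + 1) ^ K : ℕ) : ℝ) ^ 2 * P.mesh 0)) * γ0 with hγT
  have hγT0 : 0 ≤ γT := by positivity
  -- the probe as a linear map into fields on a one-point index set
  let ev : HiggsLattice.Site P 0 → (HiggsLattice.ScalarField P 0 N →ₗ[ℝ] EuclideanSpace ℝ (Fin N)) :=
    fun y => LinearMap.proj y
  let Dl : HiggsLattice.PBond P 0 → (HiggsLattice.ScalarField P 0 N →ₗ[ℝ] EuclideanSpace ℝ (Fin N)) :=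
    fun b => (P.mesh 0)⁻¹ • (((C.U (P.mesh 0) (A b)).toLinearMap).comp (ev b.tgt) - ev b.src)
  have hDl : ∀ (ψ : HiggsLattice.ScalarField P 0 N) (b : HiggsLattice.PBond P 0), Dl b ψ = covDeriv C A ψ b := fun ψ b => rfl
  let T : HiggsLattice.ScalarField P 0 N →ₗ[ℝ] (Unit → EuclideanSpace ℝ (Fin N)) :=
    LinearMap.pi fun _ : Unit => ((hol C A x l).toLinearMap).comp (Dl ⟨x', μ⟩) - Dl ⟨x, μ⟩
  have hT : ∀ (ψ : HiggsLattice.ScalarField P 0 N) (b : Unit),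
      T ψ b = hol C A x l (covDeriv C A ψ ⟨x', μ⟩) - covDeriv C A ψ ⟨x, μ⟩ := fun ψ b => rfl
  have h := norm_obs_inverse_apply_le_of_dist (X := HiggsLattice.Site P 0) (E := EuclideanSpace ℝ (Fin N)) (J := Lab P K K₀)
    (B := Unit) (E' := EuclideanSpace ℝ (Fin N))
    (covOpK C Finset.univ A msq a K) (isUnit_covOpK C Finset.univ A hmsq a K hak)
    (fun j => covOpK C (cube K K₀ j) (cubeVec K K₀ j A) msq a K)
    (fun j => propagatorK C (cube K K₀ j) (cubeVec K K₀ j A) msq a K)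
    (fun j => covOpK_mul_propagatorK C (cube K K₀ j) (cubeVec K K₀ j A) hmsq a K hak)
    (hTor K K₀) (sum_hTor_sq hK hK₀ hK₀')
    (fun j ψ => covOpK_hTor_agree C hK hK₀ hK₀8 j A msq a ψ)
    (fun j => Finset.univ.filter (Near K K₀ rH j))
    (fun j y hy => by
      rw [Finset.mem_filter]
      exact ⟨Finset.mem_univ _, near_mono (by omega) (near_rS_of_hTor_ne_zero hK hK₀ hK₀8 hy)⟩)
    (fun j θ y hy => commutator_row_zero C hK hK₀ hK₀8 j A msq a θ (fun hn => hy (by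
      rw [Finset.mem_filter]; exact ⟨Finset.mem_univ _, near_mono (by omega) hn⟩)))
    (2 ^ P.d)
    (fun y => by
      have e : (Finset.univ.filter fun j : Lab P K K₀ => y ∈ Finset.univ.filter (Near K K₀ rH j))
          = Finset.univ.filter fun j : Lab P K K₀ => Near K K₀ rH j y := by
        ext j'; simp
      rw [e]
      exact card_filter_near_le hK hK₀ hK₀' hrH_lt y)
    hβ hKj T (fun _ => x)
    (fun j F b hb => by
      rw [hT]
      exact probe_hsmul_eq_zero_off C hK hK₀ hK₀8 j A F hch hend hlenN (fun hn => hb (by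
        rw [Finset.mem_filter]; exact ⟨Finset.mem_univ _, hn⟩)))
    hγT0
    (fun j ψ => by
      refine (pi_norm_le_iff_of_nonneg (by positivity)).2 fun b => ?_
      rw [hT]
      have hψ := norm_nonneg ψ
      have hP := norm_probe_hsmul_le C hK hK₀ hK₀8 hN3 hroom j A
        (propagatorK C (cube K K₀ j) (cubeVec K K₀ j A) msq a K (hTor K K₀ j • ψ))
        (γ0 := γ0 * ‖ψ‖) (γD := γD * ‖ψ‖) (γH := γH * ‖ψ‖) (by positivity) (by positivity) (by positivity) μ hch hend hlen hnear
        (fun y => (norm_le_pi_norm _ y).trans (hGj j ψ)) (fun y ν hy hs => hDj j ψ y ν hy hs)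
        (fun h1 h2 h3 h4 h5 => hHj j ψ h1 h2 h3 h4 h5)
      refine hP.trans (le_of_eq ?_)
      rw [hγT]; ring)
    (fun y z => (HiggsLattice.Site.tdist y z : ℝ)) (fun y => by exact_mod_cast tdist_self y) (fun y z => Nat.cast_nonneg _)
    (fun y z w => tdist_triangle_real y z w)
    (diam := 2 * (rH : ℕ))
    (fun j y hy y' hy' => by
      rw [Finset.mem_filter] at hy hy'
      exact_mod_cast tdist_le_of_near hy.2 hy'.2)
    hδ (by push_cast at hsmall ⊢; exact hsmall) φ hφ hD0 () hD
  rw [hT] at h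
  have e2 : ((2 ^ P.d : ℕ) : ℝ) = 2 ^ P.d := by push_cast; ring
  rw [e2] at h
  exact h

end Torus

/-! ## §2 The cube inputs at `Ã_j` for the background `A^{(K),ε}`: value, derivative, Hölder and (2.20) members -/

section CubeInputs

set_option maxHeartbeats 400000 in
/-- **THE TORUS-WALK INPUTS FOR THE HÖLDER MEMBER AT THE BACKGROUND `A^{(K),ε}` OF (3.29)**: constants `C_γ, C_δ, C_H, C_β > 0` and thresholds
`c_A(K₀) > 0` such that for `K₀ ≧ 8`, on every torus with `K₀ ∣ M`, at every level `1 ≦ K ≦ K_P` with `3·L^KK₀ ≦ |T_ε|_μ`, `L^Kε ≦ ε₀`, for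
`r·L^Kε ≦ c_A(K₀)`, `|A| ≦ r`, every cube satisfies, for `u_j = G_j(h_jψ)` at `Ã_j`: `‖u_j‖_∞ ≦ C_γ(L^Kε)²‖ψ‖_∞`, `‖D^ε_{Ã_j}u_j(b)‖ ≦
C_δ(L^Kε)‖ψ‖_∞` on the bonds of `□_j`, the HÖLDER member `‖U(Ã_j(Γ))D^ε_{Ã_j}u_j(⟨x′,μ⟩) − D^ε_{Ã_j}u_j(⟨x,μ⟩)‖ ≦ C_H(|x − x′|/L^K)^α(L^Kε)‖ψ‖_∞`
for nearest-neighbour chains `Γ ⊂ □_j` with `|Γ| ≦ d|x − x′|`, and `‖K_ju_j‖_∞ ≦ (C_β/K₀)‖ψ‖_∞` — gen 8's `cube_inputs`, gen 9's `cube_input_deriv`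
and this seat's `cube_input_holder` at the common charge `e_c = min(e₁, e₂, e₃)`, with the (2.23)-regularity `norm_sderiv_bgVec_le`.
[cite: Balaban1982Higgs1, (2.23) p.610, (3.29) p.617] [cite: Balaban1983RegularityDecay, Lemma 2.2 (2.16)–(2.17) p.578, (2.20) p.578] -/
theorem cube_inputs_holder_bgVec (d L : ℕ) (hd : 1 ≤ d) (hL : Odd L ∧ 1 < L) {a : ℝ} (ha : 0 < a)
    {mu0sq msq : ℝ} (hmu : 0 < mu0sq) (hmsq : 0 < msq) (N : ℕ) (C : ChargeData N) (ε₀ : ℝ) {α : ℝ} (hα0 : 0 ≤ α) (hα1 : α < 1) :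
    ∃ Cγ Cδ CH Cβ : ℝ, 0 < Cγ ∧ 0 < Cδ ∧ 0 < CH ∧ 0 < Cβ ∧ ∃ cA : ℕ → ℝ, (∀ K₀, 0 < cA K₀) ∧ ∀ K₀ : ℕ, 8 ≤ K₀ →
      ∀ (P : HiggsLattice.Params) (_S : Shape P), P.d = d → P.L = L → K₀ ∣ P.M →
      ∀ {K : ℕ}, 1 ≤ K → K ≤ P.K → (∀ μ, 3 * half P K K₀ ≤ P.sitesPerDir 0 μ) → P.mesh K ≤ ε₀ →
      ∀ {r : ℝ}, r * P.mesh K ≤ cA K₀ →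
      ∀ A : HiggsLattice.VecField P K, (∀ x, ‖toSite A x‖ ≤ r) → ∀ j : Lab P K K₀,
        (∀ ψ : HiggsLattice.ScalarField P 0 N,
            ‖propagatorK C (cube K K₀ j) (cubeVec K K₀ j (bgVec mu0sq a K A)) msq a K (hTor K K₀ j • ψ)‖ ≤ Cγ * P.mesh K ^ 2 * ‖ψ‖) ∧
        (∀ (ψ : HiggsLattice.ScalarField P 0 N) (x : HiggsLattice.Site P 0) (μ : Fin P.d), x ∈ cube K K₀ j → x.shift μ ∈ cube K K₀ j →
            ‖covDeriv C (cubeVec K K₀ j (bgVec mu0sq a K A))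
                (propagatorK C (cube K K₀ j) (cubeVec K K₀ j (bgVec mu0sq a K A)) msq a K (hTor K K₀ j • ψ)) ⟨x, μ⟩‖
              ≤ Cδ * P.mesh K * ‖ψ‖) ∧
        (∀ (ψ : HiggsLattice.ScalarField P 0 N) (μ : Fin P.d) (x x' : HiggsLattice.Site P 0) (l : List (HiggsLattice.Site P 0)),
            x ∈ cube K K₀ j → x.shift μ ∈ cube K K₀ j → x' ∈ cube K K₀ j → x'.shift μ ∈ cube K K₀ j → x' ≠ x →
            IsTChain x l → pathEnd x l = x' → (∀ y ∈ l, y ∈ cube K K₀ j) →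
            (l.length : ℝ) ≤ (P.d : ℝ) * HiggsLattice.Site.tdist x x' →
            ‖hol C (cubeVec K K₀ j (bgVec mu0sq a K A)) x l
                  (covDeriv C (cubeVec K K₀ j (bgVec mu0sq a K A))
                    (propagatorK C (cube K K₀ j) (cubeVec K K₀ j (bgVec mu0sq a K A)) msq a K (hTor K K₀ j • ψ)) ⟨x', μ⟩)
                - covDeriv C (cubeVec K K₀ j (bgVec mu0sq a K A))
                    (propagatorK C (cube K K₀ j) (cubeVec K K₀ j (bgVec mu0sq a K A)) msq a K (hTor K K₀ j • ψ)) ⟨x, μ⟩‖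
              ≤ CH * ((HiggsLattice.Site.tdist x x' : ℝ) / (P.L : ℝ) ^ K) ^ α * P.mesh K * ‖ψ‖) ∧
        (∀ ψ : HiggsLattice.ScalarField P 0 N,
            ‖covOpK C (cube K K₀ j) (cubeVec K K₀ j (bgVec mu0sq a K A)) msq a K
                (hTor K K₀ j • propagatorK C (cube K K₀ j) (cubeVec K K₀ j (bgVec mu0sq a K A)) msq a K (hTor K K₀ j • ψ))
              - hTor K K₀ j • covOpK C (cube K K₀ j) (cubeVec K K₀ j (bgVec mu0sq a K A)) msq a K
                (propagatorK C (cube K K₀ j) (cubeVec K K₀ j (bgVec mu0sq a K A)) msq a K (hTor K K₀ j • ψ))‖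
              ≤ Cβ / K₀ * ‖ψ‖) := by
  have hℓ0 : 1 ≤ L - 1 := by have := hL.2; omega
  -- the constants of the cube inputs (Lemma 2.2 at charge 1: value/(2.20), derivative and Hölder members) and of the zero-field clause
  obtain ⟨Cγ, Cβ, hCγ, hCβ, hci⟩ := cube_inputs C (d - 1) (L - 1) hℓ0 a a (msq * ε₀ ^ 2) ha
  obtain ⟨Cδ, hCδ, hdi⟩ := cube_input_deriv C (d - 1) (L - 1) hℓ0 a a (msq * ε₀ ^ 2) ha
  obtain ⟨CH, hCH, hhi⟩ := cube_input_holder C (d - 1) (L - 1) hℓ0 a a (msq * ε₀ ^ 2) ha hα0 hα1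
  obtain ⟨c', hc', hder⟩ := covDeriv_propagatorK_sup_bound d L d hd hL ha hmu.le ε₀
  -- the three charge thresholds for the regularity pair `(1, ½)`, as functions of the cube size, and the common charge
  have hci' : ∀ K₀ : ℕ, ∃ e₁ : ℝ, 0 < e₁ ∧ _ := fun K₀ => hci 1 (1 / 2) zero_le_one (by norm_num) (max K₀ 8) (le_max_right _ _)
  have hdi' : ∀ K₀ : ℕ, ∃ e₁ : ℝ, 0 < e₁ ∧ _ := fun K₀ => hdi 1 (1 / 2) zero_le_one (by norm_num) (max K₀ 8) (le_max_right _ _)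
  have hhi' : ∀ K₀ : ℕ, ∃ e₁ : ℝ, 0 < e₁ ∧ _ := fun K₀ => hhi 1 (1 / 2) zero_le_one (by norm_num) (max K₀ 8) (le_max_right _ _)
  choose e₁ he₁ hthr' using hci'
  choose e₂ he₂ hdthr' using hdi'
  choose e₃ he₃ hhthr' using hhi'
  refine ⟨Cγ, Cδ, CH, Cβ, hCγ, hCδ, hCH, hCβ,
    fun K₀ => Real.sqrt (min (min (e₁ K₀) (e₂ K₀)) (e₃ K₀)) / (|C.e| * a * c' + 1), fun K₀ => by
      have : 0 < min (min (e₁ K₀) (e₂ K₀)) (e₃ K₀) := lt_min (lt_min (he₁ K₀) (he₂ K₀)) (he₃ K₀)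
      positivity,
    fun K₀ hK₀8 => ?_⟩
  have hmax : max K₀ 8 = K₀ := max_eq_left hK₀8
  have hthr := hthr' K₀
  have hdthr := hdthr' K₀
  have hhthr := hhthr' K₀
  rw [hmax] at hthr hdthr hhthr
  intro P S hPd hPL hK₀M K hK1 hK hN3 hε r hr A hA j
  subst hPd
  set ec : ℝ := min (min (e₁ K₀) (e₂ K₀)) (e₃ K₀) with hec_def
  have hec0 : 0 < ec := lt_min (lt_min (he₁ K₀) (he₂ K₀)) (he₃ K₀)
  have hec1 : ec ≤ e₁ K₀ := (min_le_left _ _).trans (min_le_left _ _)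
  have hec2 : ec ≤ e₂ K₀ := (min_le_left _ _).trans (min_le_right _ _)
  have hec3 : ec ≤ e₃ K₀ := min_le_right _ _
  have hL1 : (1 : ℝ) < P.L := by rw [hPL]; exact_mod_cast hL.2
  have hdd : dd P = P.d - 1 := rfl
  have hPL1 : P.L - 1 = L - 1 := by rw [hPL]
  have hmesh : 0 < P.mesh K := P.mesh_pos K
  have hmesh0 : 0 < P.mesh 0 := P.mesh_pos 0
  have hcap : msq * P.mesh K ^ 2 ≤ msq * ε₀ ^ 2 :=
    mul_le_mul_of_nonneg_left (pow_le_pow_left₀ hmesh.le hε 2) hmsq.le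
  have hr0 : 0 ≤ r := (norm_nonneg _).trans (hA (HiggsAveraging.blockIter K (default : HiggsLattice.Site P 0)))
  set Abg : HiggsLattice.VecField P 0 := bgVec mu0sq a K A with hAbg
  -- the regularity (2.23) of the background in the lineage's (1.7) form, at charge `e_c`, pair `(1, ½)`
  have hnR : ((((P.L - 1 + 1) ^ K : ℕ)) : ℝ) = (P.L : ℝ) ^ K := by
    rw [B1TorusCubeChart.predL_succ, Nat.cast_pow]
  have hmeshK : P.mesh K = (P.L : ℝ) ^ K * P.mesh 0 := by
    unfold HiggsLattice.Params.mesh; ring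
  have hD' := norm_sderiv_bgVec_le hK1 hL1 ha
    (fun ψ M' hψ b => hder P S rfl hPL (zeroCharge P.d) hK1 hK hε ψ M' hψ b) A hA
  have h17 : ∀ y ∈ Box (dd P) (P.L - 1) K (B1TorusCubeChart.M2 P K₀), ∀ i i' : Fin (dd P + 1),
      |acT K K₀ j ((((P.L - 1 + 1) ^ K : ℕ) : ℝ) * P.mesh 0 * C.e / ec) Abg (y + e1 i) i'
        - acT K K₀ j ((((P.L - 1 + 1) ^ K : ℕ) : ℝ) * P.mesh 0 * C.e / ec) Abg y i'|
        ≤ 1 * ec ^ ((1 : ℝ) / 2 - 1) / ((P.L - 1 + 1) ^ K : ℕ) := by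
    intro y _ i i'
    unfold acT
    rw [toT_add_e1, ← mul_sub, abs_mul, apply_shift_sub_eq, hnR]
    have hsd := (le_of_eq_of_le (Real.norm_eq_abs _).symm
      (PiLp.norm_apply_le (sderiv (toSite Abg) ⟨toT K K₀ j y, castD P i⟩) (castD P i'))).trans (hD' ⟨toT K K₀ j y, castD P i⟩)
    have hpow : (0 : ℝ) < (P.L : ℝ) ^ K := by positivity
    have hσ : |(P.L : ℝ) ^ K * P.mesh 0 * C.e / ec| = (P.L : ℝ) ^ K * P.mesh 0 * |C.e| / ec := by
      rw [abs_div, abs_mul, abs_mul, abs_of_pos hpow, abs_of_pos hmesh0, abs_of_pos hec0]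
    rw [hσ, abs_mul, abs_of_pos hmesh0]
    have hexp : ec ^ ((1 : ℝ) / 2 - 1) = (Real.sqrt (ec))⁻¹ := by
      rw [show (1 : ℝ) / 2 - 1 = -(1 / 2) by norm_num, Real.rpow_neg hec0.le, Real.sqrt_eq_rpow]
    rw [hexp, one_mul]
    -- the key smallness: `r·L^Kε·(|e| a c′) ≦ √e_c`, from `r·L^Kε ≦ c_A`
    have hkey : r * P.mesh K * (|C.e| * a * c') ≤ Real.sqrt (ec) := by
      have h1 : r * P.mesh K * (|C.e| * a * c') ≤ r * P.mesh K * (|C.e| * a * c' + 1) :=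
        mul_le_mul_of_nonneg_left (by linarith) (by positivity)
      refine h1.trans ?_
      have hr' := hr
      simp only at hr'
      rw [le_div_iff₀ (by positivity)] at hr'
      exact hr'
    calc (P.L : ℝ) ^ K * P.mesh 0 * |C.e| / ec * (P.mesh 0 * |(sderiv (toSite Abg) ⟨toT K K₀ j y, castD P i⟩) (castD P i')|)
        ≤ (P.L : ℝ) ^ K * P.mesh 0 * |C.e| / ec * (P.mesh 0 * (a * c' * (P.mesh K)⁻¹ * r)) :=
          mul_le_mul_of_nonneg_left (mul_le_mul_of_nonneg_left hsd hmesh0.le) (by positivity)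
      _ = (r * P.mesh K * (|C.e| * a * c')) / (ec * (P.L : ℝ) ^ K) := by
          rw [hmeshK]; field_simp
      _ ≤ Real.sqrt (ec) / (ec * (P.L : ℝ) ^ K) := div_le_div_of_nonneg_right hkey (by positivity)
      _ = (Real.sqrt (ec))⁻¹ / ((P.L : ℝ) ^ K) := by
          rw [← Real.sqrt_div_self, div_div]
  have hGK := hthr P hdd hPL1 K hK1 hK hK₀M hN3 a msq le_rfl le_rfl hmsq hcap j Abg ec hec0 hec1 h17
  have hDD := hdthr P hdd hPL1 K hK1 hK hK₀M hN3 a msq le_rfl le_rfl hmsq hcap j Abg ec hec0 hec2 h17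
  have hHH := hhthr P hdd hPL1 K hK1 hK hK₀M hN3 a msq le_rfl le_rfl hmsq hcap j Abg ec hec0 hec3 h17
  exact ⟨hGK.1, hDD, hHH, hGK.2⟩

end CubeInputs

end Literature.MathematicalPhysics.QuantumFieldTheory.Balaban1983to89.B1Ineq224BackgroundTorusWalk
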